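import Literature.MathematicalPhysics.QuantumFieldTheory.PinnedOneLinkLaplace
import HarnessLib

/-!
# First-order Taylor expansion of lattice words at the identity, with quadratic remainder

Second file of the proof of the named fact
`Literature.MathematicalPhysics.QuantumFieldTheory.OneLinkLaplaceConcentration`
(`PinnedOneLinkLaplace.lean`). The perturbation of the pinned one-link law is a combination of
*words* `Re tr(ℓ₀ ℓ₁ ℓ₂ᴴ ℓ₃ᴴ)` whose letters are either the variable link `B X` (re-centred at a
group element `B`) or constant unitaries. For the Morse-type bounds of the Laplace argument
(`PinnedOneLinkLaplaceMorse.lean`) one needs, uniformly over all such words, a decomposition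

  `f(X) - f(1) = D(X - 1) + R(X)`,  `D` real-linear, `|D Z| ≤ c₁ ‖Z‖_F`, `|R(X)| ≤ c₂ ‖X - 1‖_F²`

on the Hilbert–Schmidt ball `‖X‖_F ≤ √N` (which contains `U(N)`), with `c₁, c₂` depending on `N`
only (`exists_word_taylor`). This is elementary multilinear algebra: each letter is affine in `X`
over `ℝ` (`Z ↦ B Z`, `Z ↦ Zᴴ Bᴴ`, or constant), and products of maps with such expansions again
have them, with the Leibniz derivative and a remainder controlled by submultiplicativity of `‖·‖_F`
(`taylor_mul`). Matrices carry the Frobenius norm (`open scoped Matrix.Norms.Frobenius`, equal to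
the tree's instance-free `frobNorm`, `frobNorm_eq_norm`). Everything is proved; no definitions
(the linear maps are produced existentially).
-/

noncomputable section

open scoped Matrix.Norms.Frobenius Matrix
open Matrix

namespace Literature.MathematicalPhysics.QuantumFieldTheory

variable {N : ℕ}

/-! ### Hilbert–Schmidt norm facts in the Frobenius instance -/

/-- `‖U‖_F = √N` for unitary `U`. [folklore] -/
theorem norm_of_mem_unitaryGroup {U : Matrix (Fin N) (Fin N) ℂ}
    (hU : U ∈ Matrix.unitaryGroup (Fin N) ℂ) : ‖U‖ = Real.sqrt N := by
  rw [← frobNorm_eq_norm, ← Real.sqrt_sq (frobNorm_nonneg _), frobNorm_sq_of_mem_unitaryGroup hU]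
  simp

/-- `‖1‖_F = √N`. [folklore] -/
theorem norm_one_eq_sqrt : ‖(1 : Matrix (Fin N) (Fin N) ℂ)‖ = Real.sqrt N :=
  norm_of_mem_unitaryGroup (Submonoid.one_mem _)

/-- `‖U A‖_F = ‖A‖_F` for unitary `U`. [folklore] -/
theorem norm_unitary_mul {U : Matrix (Fin N) (Fin N) ℂ} (hU : U ∈ Matrix.unitaryGroup (Fin N) ℂ)
    (A : Matrix (Fin N) (Fin N) ℂ) : ‖U * A‖ = ‖A‖ := by
  rw [← frobNorm_eq_norm, ← frobNorm_eq_norm, frobNorm_unitary_mul hU]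

/-- `‖A U‖_F = ‖A‖_F` for unitary `U`. [folklore] -/
theorem norm_mul_unitary (A : Matrix (Fin N) (Fin N) ℂ) {U : Matrix (Fin N) (Fin N) ℂ}
    (hU : U ∈ Matrix.unitaryGroup (Fin N) ℂ) : ‖A * U‖ = ‖A‖ := by
  rw [← frobNorm_eq_norm, ← frobNorm_eq_norm, frobNorm_mul_unitary A hU]

/-- `‖Aᴴ‖_F = ‖A‖_F`. [folklore] -/
theorem norm_conjTranspose' (A : Matrix (Fin N) (Fin N) ℂ) : ‖Aᴴ‖ = ‖A‖ := by
  rw [← frobNorm_eq_norm, ← frobNorm_eq_norm, frobNorm_conjTranspose]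

/-- `|Re tr T| ≤ √N ‖T‖_F` (Cauchy–Schwarz against the identity). [folklore] -/
theorem abs_re_trace_le_sqrt_mul (T : Matrix (Fin N) (Fin N) ℂ) :
    |T.trace.re| ≤ Real.sqrt N * ‖T‖ := by
  have := abs_re_trace_mul_le (1 : Matrix (Fin N) (Fin N) ℂ) T
  rwa [one_mul, frobNorm_eq_norm, frobNorm_eq_norm, norm_one_eq_sqrt] at this

/-- On the ball `‖X‖_F ≤ √N` one has `‖X - 1‖_F ≤ 2 √N`. [folklore] -/
theorem norm_sub_one_le_of_norm_le {X : Matrix (Fin N) (Fin N) ℂ} (hX : ‖X‖ ≤ Real.sqrt N) :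
    ‖X - 1‖ ≤ 2 * Real.sqrt N := by
  calc ‖X - 1‖ ≤ ‖X‖ + ‖(1 : Matrix (Fin N) (Fin N) ℂ)‖ := norm_sub_le _ _
    _ ≤ Real.sqrt N + Real.sqrt N := add_le_add hX norm_one_eq_sqrt.le
    _ = 2 * Real.sqrt N := by ring

/-! ### The product rule for first-order expansions with quadratic remainder -/

/-- **Leibniz rule with quadratic remainder.** If `U` and `V` admit on the ball `‖X‖_F ≤ √N`
expansions `U X = U₁ + DU(X-1) + O(‖X-1‖²)`, `V X = V₁ + DV(X-1) + O(‖X-1‖²)` with real-linear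
`DU, DV` and the stated bounds, then so does `U V`, with derivative `Z ↦ DU(Z) V₁ + U₁ DV(Z)`:
`UV - U₁V₁ - (DU(Z)V₁ + U₁DV(Z)) = R_U V₁ + (DU(Z) + R_U) DV(Z) + U R_V`. [folklore] -/
theorem taylor_mul {U V : Matrix (Fin N) (Fin N) ℂ → Matrix (Fin N) (Fin N) ℂ}
    {U₁ V₁ : Matrix (Fin N) (Fin N) ℂ}
    {DU DV : Matrix (Fin N) (Fin N) ℂ →ₗ[ℝ] Matrix (Fin N) (Fin N) ℂ}
    {bU dU cU bV dV cV : ℝ} (hbU : 0 ≤ bU) (hdU : 0 ≤ dU) (hcU : 0 ≤ cU)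
    (hdV : 0 ≤ dV)
    (hU : ∀ X, ‖X‖ ≤ Real.sqrt N → ‖U X‖ ≤ bU) (hU₁ : ‖U₁‖ ≤ bU)
    (hDU : ∀ Z, ‖DU Z‖ ≤ dU * ‖Z‖)
    (hRU : ∀ X, ‖X‖ ≤ Real.sqrt N → ‖U X - U₁ - DU (X - 1)‖ ≤ cU * ‖X - 1‖ ^ 2)
    (hV : ∀ X, ‖X‖ ≤ Real.sqrt N → ‖V X‖ ≤ bV) (hV₁ : ‖V₁‖ ≤ bV)
    (hDV : ∀ Z, ‖DV Z‖ ≤ dV * ‖Z‖)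
    (hRV : ∀ X, ‖X‖ ≤ Real.sqrt N → ‖V X - V₁ - DV (X - 1)‖ ≤ cV * ‖X - 1‖ ^ 2) :
    (∀ X, ‖X‖ ≤ Real.sqrt N → ‖U X * V X‖ ≤ bU * bV) ∧ ‖U₁ * V₁‖ ≤ bU * bV ∧
    (∀ Z, ‖(LinearMap.mulRight ℝ V₁ ∘ₗ DU + LinearMap.mulLeft ℝ U₁ ∘ₗ DV) Z‖ ≤
        (dU * bV + bU * dV) * ‖Z‖) ∧
    (∀ X, ‖X‖ ≤ Real.sqrt N → ‖U X * V X - U₁ * V₁ -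
        (LinearMap.mulRight ℝ V₁ ∘ₗ DU + LinearMap.mulLeft ℝ U₁ ∘ₗ DV) (X - 1)‖ ≤
        (cU * bV + dU * dV + cU * dV * (2 * Real.sqrt N) + bU * cV) * ‖X - 1‖ ^ 2) := by
  have hbV : 0 ≤ bV := (norm_nonneg _).trans hV₁
  refine ⟨fun X hX => ?_, ?_, fun Z => ?_, fun X hX => ?_⟩
  · exact (norm_mul_le _ _).trans (mul_le_mul (hU X hX) (hV X hX) (norm_nonneg _) hbU)
  · exact (norm_mul_le _ _).trans (mul_le_mul hU₁ hV₁ (norm_nonneg _) hbU)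
  · simp only [LinearMap.add_apply, LinearMap.comp_apply, LinearMap.mulRight_apply,
      LinearMap.mulLeft_apply]
    calc ‖DU Z * V₁ + U₁ * DV Z‖ ≤ ‖DU Z‖ * ‖V₁‖ + ‖U₁‖ * ‖DV Z‖ :=
          (norm_add_le _ _).trans (add_le_add (norm_mul_le _ _) (norm_mul_le _ _))
      _ ≤ dU * ‖Z‖ * bV + bU * (dV * ‖Z‖) :=
          add_le_add (mul_le_mul (hDU Z) hV₁ (norm_nonneg _) (by positivity))
            (mul_le_mul hU₁ (hDV Z) (norm_nonneg _) hbU)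
      _ = (dU * bV + bU * dV) * ‖Z‖ := by ring
  · set Z := X - 1 with hZ
    set RU := U X - U₁ - DU Z with hRU'
    set RV := V X - V₁ - DV Z with hRV'
    have hz : ‖Z‖ ≤ 2 * Real.sqrt N := norm_sub_one_le_of_norm_le hX
    have hid : U X * V X - U₁ * V₁ -
        (LinearMap.mulRight ℝ V₁ ∘ₗ DU + LinearMap.mulLeft ℝ U₁ ∘ₗ DV) Z =
        RU * V₁ + (DU Z + RU) * DV Z + U X * RV := by
      simp only [LinearMap.add_apply, LinearMap.comp_apply, LinearMap.mulRight_apply,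
        LinearMap.mulLeft_apply, hRU', hRV']
      noncomm_ring
    rw [hid]
    have h1 : ‖RU * V₁‖ ≤ cU * ‖Z‖ ^ 2 * bV :=
      (norm_mul_le _ _).trans (mul_le_mul (hRU X hX) hV₁ (norm_nonneg _) (by positivity))
    have h2 : ‖(DU Z + RU) * DV Z‖ ≤ (dU * ‖Z‖ + cU * ‖Z‖ ^ 2) * (dV * ‖Z‖) :=
      (norm_mul_le _ _).trans (mul_le_mul ((norm_add_le _ _).trans (add_le_add (hDU Z) (hRU X hX)))
        (hDV Z) (norm_nonneg _) (by positivity))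
    have h3 : ‖U X * RV‖ ≤ bU * (cV * ‖Z‖ ^ 2) :=
      (norm_mul_le _ _).trans (mul_le_mul (hU X hX) (hRV X hX) (norm_nonneg _) hbU)
    have h4 : cU * ‖Z‖ ^ 2 * (dV * ‖Z‖) ≤ cU * dV * (2 * Real.sqrt N) * ‖Z‖ ^ 2 := by
      have : cU * dV * ‖Z‖ ^ 2 * ‖Z‖ ≤ cU * dV * ‖Z‖ ^ 2 * (2 * Real.sqrt N) :=
        mul_le_mul_of_nonneg_left hz (by positivity)
      linarith
    calc ‖RU * V₁ + (DU Z + RU) * DV Z + U X * RV‖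
        ≤ ‖RU * V₁‖ + ‖(DU Z + RU) * DV Z‖ + ‖U X * RV‖ := norm_add₃_le
      _ ≤ cU * ‖Z‖ ^ 2 * bV + (dU * ‖Z‖ + cU * ‖Z‖ ^ 2) * (dV * ‖Z‖) + bU * (cV * ‖Z‖ ^ 2) :=
          add_le_add (add_le_add h1 h2) h3
      _ ≤ (cU * bV + dU * dV + cU * dV * (2 * Real.sqrt N) + bU * cV) * ‖Z‖ ^ 2 := by
          nlinarith [h4]

/-! ### Letters -/

/-- **The variable letter** `X ↦ B X` (`B` unitary) and **constant letters** (unitary constants):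
`ℓ(X) = p.elim (B X) id` has the expansion `ℓ(1) + Dℓ(X - 1)` with NO remainder, `Dℓ = B ·` or
`0`, and `‖ℓ X‖_F ≤ √N` on the ball, `‖Dℓ Z‖_F ≤ ‖Z‖_F`. [folklore] -/
theorem exists_letter_taylor {B : Matrix (Fin N) (Fin N) ℂ} (hB : B ∈ Matrix.unitaryGroup (Fin N) ℂ)
    (p : Option (Matrix (Fin N) (Fin N) ℂ)) (hp : ∀ C, p = some C → C ∈ Matrix.unitaryGroup (Fin N) ℂ) :
    ∃ D : Matrix (Fin N) (Fin N) ℂ →ₗ[ℝ] Matrix (Fin N) (Fin N) ℂ,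
      (∀ X, ‖X‖ ≤ Real.sqrt N → ‖p.elim (B * X) (fun C => C)‖ ≤ Real.sqrt N) ∧
      ‖p.elim (B * 1) (fun C => C)‖ ≤ Real.sqrt N ∧
      (∀ Z, ‖D Z‖ ≤ 1 * ‖Z‖) ∧
      (∀ X, ‖X‖ ≤ Real.sqrt N →
        ‖p.elim (B * X) (fun C => C) - p.elim (B * 1) (fun C => C) - D (X - 1)‖ ≤ 0 * ‖X - 1‖ ^ 2) := by
  cases p with
  | none =>
    refine ⟨LinearMap.mulLeft ℝ B, fun X hX => ?_, ?_, fun Z => ?_, fun X _ => ?_⟩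
    · simpa [Option.elim, norm_unitary_mul hB] using hX
    · simp [Option.elim, norm_of_mem_unitaryGroup hB]
    · simp [norm_unitary_mul hB]
    · simp [Option.elim, mul_sub]
  | some C =>
    have hC := hp C rfl
    refine ⟨0, fun X _ => ?_, ?_, fun Z => ?_, fun X _ => ?_⟩
    · simp [Option.elim, norm_of_mem_unitaryGroup hC]
    · simp [Option.elim, norm_of_mem_unitaryGroup hC]
    · simp
    · simp [Option.elim]

/-- **The conjugate-transposed letters** `X ↦ (ℓ X)ᴴ`: same bounds, derivative `Z ↦ (Dℓ Z)ᴴ`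
(conjugate transposition is real-linear and `‖·‖_F`-isometric). [folklore] -/
theorem exists_letter_conjTranspose_taylor {B : Matrix (Fin N) (Fin N) ℂ}
    (hB : B ∈ Matrix.unitaryGroup (Fin N) ℂ)
    (p : Option (Matrix (Fin N) (Fin N) ℂ)) (hp : ∀ C, p = some C → C ∈ Matrix.unitaryGroup (Fin N) ℂ) :
    ∃ D : Matrix (Fin N) (Fin N) ℂ →ₗ[ℝ] Matrix (Fin N) (Fin N) ℂ,
      (∀ X, ‖X‖ ≤ Real.sqrt N → ‖(p.elim (B * X) (fun C => C))ᴴ‖ ≤ Real.sqrt N) ∧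
      ‖(p.elim (B * 1) (fun C => C))ᴴ‖ ≤ Real.sqrt N ∧
      (∀ Z, ‖D Z‖ ≤ 1 * ‖Z‖) ∧
      (∀ X, ‖X‖ ≤ Real.sqrt N →
        ‖(p.elim (B * X) (fun C => C))ᴴ - (p.elim (B * 1) (fun C => C))ᴴ - D (X - 1)‖ ≤
          0 * ‖X - 1‖ ^ 2) := by
  obtain ⟨D, h1, h2, h3, h4⟩ := exists_letter_taylor hB p hp
  let H : Matrix (Fin N) (Fin N) ℂ →ₗ[ℝ] Matrix (Fin N) (Fin N) ℂ :=
    { toFun := fun Z => Zᴴ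
      map_add' := fun Z Z' => Matrix.conjTranspose_add Z Z'
      map_smul' := fun c Z => by
        rw [Matrix.conjTranspose_smul, RingHom.id_apply, star_trivial] }
  have hH : ∀ Z, H Z = Zᴴ := fun Z => rfl
  refine ⟨H ∘ₗ D, fun X hX => ?_, ?_, fun Z => ?_, fun X hX => ?_⟩
  · rw [norm_conjTranspose']; exact h1 X hX
  · rw [norm_conjTranspose']; exact h2
  · rw [LinearMap.comp_apply, hH, norm_conjTranspose']; exact h3 Z
  · rw [LinearMap.comp_apply, hH, ← Matrix.conjTranspose_sub, ← Matrix.conjTranspose_sub,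
      norm_conjTranspose']
    exact h4 X hX

/-! ### Words of length four -/

/-- **First-order expansion of a word at the identity, with quadratic remainder, uniformly in the
word.** There are `c₁, c₂ ≥ 0` depending only on `N` such that for every unitary `B`, every
pattern `p : Fin 4 → Option U(N)` of constant letters, the word
`f(X) = Re tr(ℓ₀ ℓ₁ ℓ₂ᴴ ℓ₃ᴴ)`, `ℓₖ = pₖ.elim (B X) id`, satisfies
`f(X) - f(1) = D(X - 1) + R(X)` with a real-linear `D`, `|D Z| ≤ c₁ ‖Z‖_F` and
`|R(X)| ≤ c₂ ‖X - 1‖_F²` for `‖X‖_F ≤ √N`. [folklore] -/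
theorem exists_word_taylor (N : ℕ) : ∃ c₁ c₂ : ℝ, 0 ≤ c₁ ∧ 0 ≤ c₂ ∧
    ∀ (B : Matrix (Fin N) (Fin N) ℂ), B ∈ Matrix.unitaryGroup (Fin N) ℂ →
    ∀ (p : Fin 4 → Option (Matrix (Fin N) (Fin N) ℂ)),
      (∀ k C, p k = some C → C ∈ Matrix.unitaryGroup (Fin N) ℂ) →
      ∃ D : Matrix (Fin N) (Fin N) ℂ →ₗ[ℝ] ℝ, (∀ Z, |D Z| ≤ c₁ * ‖Z‖) ∧
        ∀ X, ‖X‖ ≤ Real.sqrt N →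
          |((p 0).elim (B * X) (fun C => C) * (p 1).elim (B * X) (fun C => C) *
              ((p 2).elim (B * X) (fun C => C))ᴴ * ((p 3).elim (B * X) (fun C => C))ᴴ).trace.re -
            ((p 0).elim (B * 1) (fun C => C) * (p 1).elim (B * 1) (fun C => C) *
              ((p 2).elim (B * 1) (fun C => C))ᴴ * ((p 3).elim (B * 1) (fun C => C))ᴴ).trace.re -
            D (X - 1)| ≤ c₂ * ‖X - 1‖ ^ 2 := by
  set s : ℝ := Real.sqrt N with hs
  have hs0 : 0 ≤ s := Real.sqrt_nonneg _
  -- constants of the two-, three- and fourfold products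
  set b₂ : ℝ := s * s
  set d₂ : ℝ := 1 * s + s * 1
  set c₂' : ℝ := 0 * s + 1 * 1 + 0 * 1 * (2 * s) + s * 0
  set b₃ : ℝ := b₂ * s
  set d₃ : ℝ := d₂ * s + b₂ * 1
  set c₃ : ℝ := c₂' * s + d₂ * 1 + c₂' * 1 * (2 * s) + b₂ * 0
  set b₄ : ℝ := b₃ * s
  set d₄ : ℝ := d₃ * s + b₃ * 1
  set c₄ : ℝ := c₃ * s + d₃ * 1 + c₃ * 1 * (2 * s) + b₃ * 0
  refine ⟨s * d₄, s * c₄, by positivity, by positivity, fun B hB p hp => ?_⟩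
  obtain ⟨D₀, a₀, b₀, e₀, r₀⟩ := exists_letter_taylor hB (p 0) (hp 0)
  obtain ⟨D₁, a₁, b₁, e₁, r₁⟩ := exists_letter_taylor hB (p 1) (hp 1)
  obtain ⟨D₂, a₂, b₂', e₂, r₂⟩ := exists_letter_conjTranspose_taylor hB (p 2) (hp 2)
  obtain ⟨D₃, a₃, b₃', e₃, r₃⟩ := exists_letter_conjTranspose_taylor hB (p 3) (hp 3)
  -- two letters
  obtain ⟨A₂, B₂, E₂, R₂⟩ := taylor_mul hs0 zero_le_one le_rfl zero_le_one a₀ b₀ e₀ r₀ a₁ b₁ e₁ r₁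
  -- three letters
  obtain ⟨A₃, B₃, E₃, R₃⟩ := taylor_mul (by positivity) (by positivity) (by positivity) zero_le_one
    A₂ B₂ E₂ R₂ a₂ b₂' e₂ r₂
  -- four letters
  obtain ⟨A₄, B₄, E₄, R₄⟩ := taylor_mul (by positivity) (by positivity) (by positivity) zero_le_one
    A₃ B₃ E₃ R₃ a₃ b₃' e₃ r₃
  -- the real-linear functional `Re tr`
  let T : Matrix (Fin N) (Fin N) ℂ →ₗ[ℝ] ℝ :=
    { toFun := fun Y => Y.trace.re
      map_add' := fun Y Y' => by rw [Matrix.trace_add, Complex.add_re]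
      map_smul' := fun c Y => by
        rw [Matrix.trace_smul, RingHom.id_apply, Complex.real_smul, Complex.re_ofReal_mul,
          smul_eq_mul] }
  have hT : ∀ Y, T Y = Y.trace.re := fun Y => rfl
  set D₄ := LinearMap.mulRight ℝ ((p 3).elim (B * 1) (fun C => C))ᴴ ∘ₗ
      (LinearMap.mulRight ℝ ((p 2).elim (B * 1) (fun C => C))ᴴ ∘ₗ
        (LinearMap.mulRight ℝ ((p 1).elim (B * 1) (fun C => C)) ∘ₗ D₀ +
          LinearMap.mulLeft ℝ ((p 0).elim (B * 1) (fun C => C)) ∘ₗ D₁) +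
        LinearMap.mulLeft ℝ ((p 0).elim (B * 1) (fun C => C) * (p 1).elim (B * 1) (fun C => C)) ∘ₗ D₂) +
      LinearMap.mulLeft ℝ ((p 0).elim (B * 1) (fun C => C) * (p 1).elim (B * 1) (fun C => C) *
        ((p 2).elim (B * 1) (fun C => C))ᴴ) ∘ₗ D₃ with hD₄
  refine ⟨T ∘ₗ D₄, fun Z => ?_, fun X hX => ?_⟩
  · rw [LinearMap.comp_apply, hT]
    calc |(D₄ Z).trace.re| ≤ s * ‖D₄ Z‖ := abs_re_trace_le_sqrt_mul _
      _ ≤ s * (d₄ * ‖Z‖) := mul_le_mul_of_nonneg_left (E₄ Z) hs0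
      _ = s * d₄ * ‖Z‖ := by ring
  · rw [LinearMap.comp_apply, hT, ← Complex.sub_re, ← Complex.sub_re, ← Matrix.trace_sub,
      ← Matrix.trace_sub]
    calc |((p 0).elim (B * X) (fun C => C) * (p 1).elim (B * X) (fun C => C) *
              ((p 2).elim (B * X) (fun C => C))ᴴ * ((p 3).elim (B * X) (fun C => C))ᴴ -
            (p 0).elim (B * 1) (fun C => C) * (p 1).elim (B * 1) (fun C => C) *
              ((p 2).elim (B * 1) (fun C => C))ᴴ * ((p 3).elim (B * 1) (fun C => C))ᴴ -
            D₄ (X - 1)).trace.re|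
        ≤ s * ‖(p 0).elim (B * X) (fun C => C) * (p 1).elim (B * X) (fun C => C) *
              ((p 2).elim (B * X) (fun C => C))ᴴ * ((p 3).elim (B * X) (fun C => C))ᴴ -
            (p 0).elim (B * 1) (fun C => C) * (p 1).elim (B * 1) (fun C => C) *
              ((p 2).elim (B * 1) (fun C => C))ᴴ * ((p 3).elim (B * 1) (fun C => C))ᴴ -
            D₄ (X - 1)‖ := abs_re_trace_le_sqrt_mul _
      _ ≤ s * (c₄ * ‖X - 1‖ ^ 2) := mul_le_mul_of_nonneg_left (R₄ X hX) hs0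
      _ = s * c₄ * ‖X - 1‖ ^ 2 := by ring

end Literature.MathematicalPhysics.QuantumFieldTheory

end
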